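import Literature.Topology.FourManifolds.SimplifiedBrokenLefschetzFibrationProofs
import Literature.Topology.FourManifolds.SurfaceGenusZeroSphere
import Literature.Topology.FourManifolds.CerfGammaFourProofs
import HarnessLib

/-!
# The lower-genus regular fibres of a genus-one simplified broken Lefschetz fibration are 2-spheres

Topic `Literature/Topology/FourManifolds`; theorems only (no definition, no named fact), towards
the named fact
`Literature.Topology.FourManifolds.nonempty_diffeomorph_sphere_four_of_sblf_genus_one_noLefschetz`
(Baykur–Kamada 2015, Lemma 11 with Cor. 14: a closed simply connected 4-manifold with a genus-1
SBLF without Lefschetz points is `S⁴`).  The printed proof (Baykur–Kamada 2015, §5, first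
paragraph of the case "one round singular circle, no Lefschetz singularity"; Hayano 2011, §2.3;
Auroux–Donaldson–Katzarkov 2005, §8.1) begins by decomposing the total space along the round
image into `X_h ≅ T² × D²`, a round cobordism and `X_l ≅ S² × D²`; the identification of the
lower side rests on **the regular fibres of genus `0` being 2-spheres**.  In the tree's
homological reading of the genus (`IsSimplifiedBrokenLefschetzFibration.fibre`:
`H₁(fibre; ℤ) ≅ ℤ^{2g}`) this is the classification of closed orientable surfaces in genus `0`
(Hirsch 1976, Ch. 9 §3, Thm. 3.5 at `p = 0`), which the tree proves by Morse theory
(`nonempty_diffeomorph_sphere_two_of_isOrientable_of_finrank_eq_zero`, `SurfaceGenusZeroSphere.lean`),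
applied to the regular fibre presented as an embedded ORIENTABLE surface
(`IsSimplifiedBrokenLefschetzFibration.exists_oriented_surface_fibre`,
`SimplifiedBrokenLefschetzFibrationProofs.lean`: iterated regular levels in the oriented `X`).

* `IsSimplifiedBrokenLefschetzFibration.exists_sphere_two_fibre_of_linearEquiv_fin_zero` — for an
  SBLF on a closed 4-manifold `X : Type` and a regular value `y` whose fibre has
  `H₁ ≅ ℤ^0`, the fibre `f⁻¹(y)` is the image of a `C^∞` topological embedding `𝕊² → X`;
* `IsSimplifiedBrokenLefschetzFibration.exists_sphere_two_fibre` — for a GENUS-ONE SBLF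
  (`h = 0`) some regular fibre is such an embedded 2-sphere (the clause `exists_lower`);
* `IsSimplifiedBrokenLefschetzFibration.sphere_two_fibre_or_finrank_eq_two` — for a genus-one
  SBLF every regular fibre is either an embedded 2-sphere or has `rank H₁ = 2` (the torus side;
  the identification of those fibres with `T²`, Hirsch Thm. 3.5 at `p = 1`, is not in the tree);
* `IsSimplifiedBrokenLefschetzFibration.exists_isSmoothEmbedding_sphere_two_fibre_of_linearEquiv_fin_zero`,
  `IsSimplifiedBrokenLefschetzFibration.exists_isSmoothEmbedding_sphere_two_fibre` — the same
  with `s : 𝕊² → X` a SMOOTH EMBEDDING (`Manifold.IsSmoothEmbedding`): the orientable fibre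
  surface is embedded with injective differential
  (`exists_orientable_surface_range_eq_preimage_injective_mfderiv`), so it is smoothly embedded
  (`isSmoothEmbedding_of_injective_of_injective_mfderiv`), and precomposition with the
  diffeomorphism `𝕊² ≅ F` keeps this (`Manifold.IsSmoothEmbedding.comp_diffeomorph`,
  `CerfGammaFourProofs.lean`).  This is the form consumed by the product structure of the sides
  (`SimplifiedBrokenLefschetzSides.lean`): the lower side is `𝕊² × ℝ²`.

Universe: `X : Type`, as in the target fact (the tree's Reeb theorem glues discs in `Type`).

## References

* R. İ. Baykur, S. Kamada, *Classification of broken Lefschetz fibrations with small fiber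
  genera*, J. Math. Soc. Japan 67 (2015), §5 (arXiv:1010.5814, p. 11), Lemma 11.
  [BaykurKamada2015]
* K. Hayano, *On genus-1 simplified broken Lefschetz fibrations*, Algebr. Geom. Topol. 11 (2011),
  §2.3. [Hayano2011]
* M. W. Hirsch, *Differential Topology*, GTM 33 (1976), Ch. 9 §3, Thm. 3.5. [HirschDT1976]
-/

noncomputable section

open scoped Manifold ContDiff Topology
open Set Function
open Literature.AlgebraicTopology.SingularHomology

namespace Literature.Topology.FourManifolds

namespace IsSimplifiedBrokenLefschetzFibration

variable {X : Type} [TopologicalSpace X] [T2Space X] [SecondCountableTopology X] [CompactSpace X]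
  [ChartedSpace (EuclideanSpace ℝ (Fin 4)) X] [IsManifold (𝓡 4) ∞ X]
  {o : SmoothOrientation (𝓡 4) X} {f : X → Metric.sphere (0 : EuclideanSpace ℝ (Fin 3)) 1}
  {L : Finset X} {h : ℕ}

/-- **A genus-`0` regular fibre of an SBLF on a closed 4-manifold is an embedded 2-sphere.**
For an SBLF `f : X → S²` (any lower genus `h`) on a compact Hausdorff second-countable `C^∞`
4-manifold `X : Type` with its orientation `o`, and a regular value `y` whose fibre satisfies
`(Fin (2 * 0) → ℤ) ≃ₗ[ℤ] H₁(f⁻¹(y); ℤ)` (the reading "genus `0`" of the fibre clauses), there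
is a `C^∞` map `s : 𝕊² → X` which is a topological embedding with `range s = f⁻¹(y)`.  Proof:
the fibre is the range of a `C^∞` topological embedding of a compact connected ORIENTABLE
surface `F` (`exists_oriented_surface_fibre`: iterated regular levels in the oriented `X`,
Hirsch 1976, Ch. 1 §3 and §4.4), `rank H₁(F) = 0` through the homeomorphism `F ≃ₜ f⁻¹(y)`, so
`F ≃ₘ 𝕊²` by the genus-`0` classification
(`nonempty_diffeomorph_sphere_two_of_isOrientable_of_finrank_eq_zero`, Hirsch Ch. 9 Thm. 3.5);
compose. [cite: HirschDT1976, Ch. 9 §3 Thm. 3.5] [cite: BaykurKamada2015, §5] -/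
theorem exists_sphere_two_fibre_of_linearEquiv_fin_zero
    (hf : IsSimplifiedBrokenLefschetzFibration o f L h)
    {y : Metric.sphere (0 : EuclideanSpace ℝ (Fin 3)) 1}
    (hy : ∀ q, f q = y → Surjective (mfderiv (𝓡 4) (𝓡 2) f q))
    (h0 : Nonempty ((Fin (2 * 0) → ℤ) ≃ₗ[ℤ] singularHomology ℤ ℤ ↥(f ⁻¹' {y}) 1)) :
    ∃ s : Metric.sphere (0 : EuclideanSpace ℝ (Fin 3)) 1 → X,
      ContMDiff (𝓡 2) (𝓡 4) ∞ s ∧ Topology.IsEmbedding s ∧ range s = f ⁻¹' {y} := by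
  obtain ⟨F, _, _, _, _, _, _, _, e, φ, hes, heemb, hrange, -, hF, -, -⟩ :=
    hf.exists_oriented_surface_fibre hy
  -- `rank H₁(F) = 0` through `F ≃ₜ f⁻¹(y)`
  obtain ⟨l⟩ := h0
  have h1 : Module.finrank ℤ (singularHomology ℤ ℤ F 1) = 0 := by
    rw [(singularHomology.mapIso ℤ ℤ φ 1).toLinearEquiv.finrank_eq, ← l.finrank_eq]
    simp
  -- the genus-`0` classification
  obtain ⟨Φ⟩ := nonempty_diffeomorph_sphere_two_of_isOrientable_of_finrank_eq_zero F hF h1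
  refine ⟨e ∘ Φ.symm, hes.comp Φ.symm.contMDiff, heemb.comp Φ.symm.toHomeomorph.isEmbedding, ?_⟩
  have hr : range (Φ.symm : Metric.sphere (0 : EuclideanSpace ℝ (Fin 3)) 1 → F) = univ :=
    eq_univ_of_forall fun z => ⟨Φ z, Φ.symm_apply_apply z⟩
  rw [range_comp, hr, image_univ, hrange]

/-- **A genus-one SBLF on a closed 4-manifold has an embedded 2-sphere as a regular fibre**: for
`IsSimplifiedBrokenLefschetzFibration o f L 0` on a compact `X : Type` there are a regular value
`y` and a `C^∞` topological embedding `s : 𝕊² → X` with `range s = f⁻¹(y)` — the lower side of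
the round image carries sphere fibres (Baykur–Kamada 2015, §5: `X_l ≅ S² × D²`; the clause
`exists_lower` with `exists_sphere_two_fibre_of_linearEquiv_fin_zero`).
[cite: BaykurKamada2015, §5] [cite: HirschDT1976, Ch. 9 §3 Thm. 3.5] -/
theorem exists_sphere_two_fibre (hf : IsSimplifiedBrokenLefschetzFibration o f L 0) :
    ∃ (y : Metric.sphere (0 : EuclideanSpace ℝ (Fin 3)) 1)
      (s : Metric.sphere (0 : EuclideanSpace ℝ (Fin 3)) 1 → X),
      (∀ q, f q = y → Surjective (mfderiv (𝓡 4) (𝓡 2) f q)) ∧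
      ContMDiff (𝓡 2) (𝓡 4) ∞ s ∧ Topology.IsEmbedding s ∧ range s = f ⁻¹' {y} := by
  obtain ⟨y, hy, hl⟩ := hf.exists_lower
  obtain ⟨s, hs, hse, hsr⟩ := hf.exists_sphere_two_fibre_of_linearEquiv_fin_zero hy hl
  exact ⟨y, s, hy, hs, hse, hsr⟩

/-- **Dichotomy of the regular fibres of a genus-one SBLF**: over a regular value `y` of
`IsSimplifiedBrokenLefschetzFibration o f L 0` (compact `X : Type`) the fibre is either an
embedded 2-sphere (`range s = f⁻¹(y)` for a `C^∞` topological embedding `s : 𝕊² → X`) or has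
`rank_ℤ H₁(f⁻¹(y); ℤ) = 2` (the higher, torus side; Baykur–Kamada 2015, §5: `X_h ≅ T² × D²`).
[cite: BaykurKamada2015, §5] [cite: HirschDT1976, Ch. 9 §3 Thm. 3.5] -/
theorem sphere_two_fibre_or_finrank_eq_two (hf : IsSimplifiedBrokenLefschetzFibration o f L 0)
    {y : Metric.sphere (0 : EuclideanSpace ℝ (Fin 3)) 1}
    (hy : ∀ q, f q = y → Surjective (mfderiv (𝓡 4) (𝓡 2) f q)) :
    (∃ s : Metric.sphere (0 : EuclideanSpace ℝ (Fin 3)) 1 → X,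
        ContMDiff (𝓡 2) (𝓡 4) ∞ s ∧ Topology.IsEmbedding s ∧ range s = f ⁻¹' {y}) ∨
      Module.finrank ℤ (singularHomology ℤ ℤ ↥(f ⁻¹' {y}) 1) = 2 := by
  rcases (hf.fibre y hy).2 with hhi | hlo
  · right
    obtain ⟨l⟩ := hhi
    rw [← l.finrank_eq]
    simp
  · exact Or.inl (hf.exists_sphere_two_fibre_of_linearEquiv_fin_zero hy hlo)

/-! ### Smooth-embedding form -/

/-- **A genus-`0` regular fibre of an SBLF on a closed 4-manifold is a smoothly embedded
2-sphere** (smooth-embedding form of `exists_sphere_two_fibre_of_linearEquiv_fin_zero`): for a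
regular value `y` with `(Fin (2 * 0) → ℤ) ≃ₗ[ℤ] H₁(f⁻¹(y); ℤ)` there is a `C^∞` embedding
`s : 𝕊² → X` (Mathlib's `Manifold.IsSmoothEmbedding`) with `range s = f⁻¹(y)`.  The fibre is
presented as an orientable surface `F` embedded with injective differential
(`exists_orientable_surface_range_eq_preimage_injective_mfderiv`), hence smoothly embedded
(`isSmoothEmbedding_of_injective_of_injective_mfderiv`, `F` compact), `F ≃ₘ 𝕊²` by the
genus-`0` classification, and a smooth embedding precomposed with a diffeomorphism is a smooth
embedding (`Manifold.IsSmoothEmbedding.comp_diffeomorph`).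
[cite: HirschDT1976, Ch. 1 §3 Thm. 3.1–3.2, Ch. 9 §3 Thm. 3.5] [cite: BaykurKamada2015, §5] -/
theorem exists_isSmoothEmbedding_sphere_two_fibre_of_linearEquiv_fin_zero
    (hf : IsSimplifiedBrokenLefschetzFibration o f L h)
    {y : Metric.sphere (0 : EuclideanSpace ℝ (Fin 3)) 1}
    (hy : ∀ q, f q = y → Surjective (mfderiv (𝓡 4) (𝓡 2) f q))
    (h0 : Nonempty ((Fin (2 * 0) → ℤ) ≃ₗ[ℤ] singularHomology ℤ ℤ ↥(f ⁻¹' {y}) 1)) :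
    ∃ s : Metric.sphere (0 : EuclideanSpace ℝ (Fin 3)) 1 → X,
      Manifold.IsSmoothEmbedding (𝓡 2) (𝓡 4) ∞ s ∧ range s = f ⁻¹' {y} := by
  obtain ⟨F, _, _, _, _, _, e, hes, heemb, hrange, hor, hde⟩ :=
    exists_orientable_surface_range_eq_preimage_injective_mfderiv hf.contMDiff hy
  have hF : IsOrientable (𝓡 2) F := hor ⟨o⟩
  have hcpt : IsCompact (range e) :=
    hrange ▸ (isClosed_singleton.preimage hf.contMDiff.continuous).isCompact
  haveI : CompactSpace F := by
    rw [← isCompact_univ_iff, heemb.isInducing.isCompact_iff, image_univ]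
    exact hcpt
  have hconn : IsConnected (range e) := hrange ▸ (hf.fibre y hy).1
  haveI : ConnectedSpace F := by
    rw [connectedSpace_iff_univ]
    refine ⟨?_, ?_⟩
    · obtain ⟨_, ⟨z, rfl⟩⟩ := hconn.nonempty
      exact ⟨z, mem_univ z⟩
    · rw [← heemb.isInducing.isPreconnected_image, image_univ]
      exact hconn.isPreconnected
  have h1le : (1 : ℕ∞ω) ≤ ∞ := by exact_mod_cast le_top
  have hemb : Manifold.IsSmoothEmbedding (𝓡 2) (𝓡 4) ∞ e :=
    isSmoothEmbedding_of_injective_of_injective_mfderiv hes h1le heemb.injective hde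
  let φ : F ≃ₜ ↥(f ⁻¹' {y}) := heemb.toHomeomorph.trans (Homeomorph.setCongr hrange)
  obtain ⟨l⟩ := h0
  have h1 : Module.finrank ℤ (singularHomology ℤ ℤ F 1) = 0 := by
    rw [(singularHomology.mapIso ℤ ℤ φ 1).toLinearEquiv.finrank_eq, ← l.finrank_eq]
    simp
  obtain ⟨Φ⟩ := nonempty_diffeomorph_sphere_two_of_isOrientable_of_finrank_eq_zero F hF h1
  refine ⟨e ∘ Φ.symm, hemb.comp_diffeomorph Φ.symm, ?_⟩
  have hr : range (Φ.symm : Metric.sphere (0 : EuclideanSpace ℝ (Fin 3)) 1 → F) = univ :=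
    eq_univ_of_forall fun z => ⟨Φ z, Φ.symm_apply_apply z⟩
  rw [range_comp, hr, image_univ, hrange]

/-- **A genus-one SBLF on a closed 4-manifold has a smoothly embedded 2-sphere as a regular
fibre** (smooth-embedding form of `exists_sphere_two_fibre`). [cite: BaykurKamada2015, §5]
[cite: HirschDT1976, Ch. 9 §3 Thm. 3.5] -/
theorem exists_isSmoothEmbedding_sphere_two_fibre
    (hf : IsSimplifiedBrokenLefschetzFibration o f L 0) :
    ∃ (y : Metric.sphere (0 : EuclideanSpace ℝ (Fin 3)) 1)
      (s : Metric.sphere (0 : EuclideanSpace ℝ (Fin 3)) 1 → X),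
      (∀ q, f q = y → Surjective (mfderiv (𝓡 4) (𝓡 2) f q)) ∧
      Manifold.IsSmoothEmbedding (𝓡 2) (𝓡 4) ∞ s ∧ range s = f ⁻¹' {y} := by
  obtain ⟨y, hy, hl⟩ := hf.exists_lower
  obtain ⟨s, hs, hsr⟩ :=
    hf.exists_isSmoothEmbedding_sphere_two_fibre_of_linearEquiv_fin_zero hy hl
  exact ⟨y, s, hy, hs, hsr⟩

end IsSimplifiedBrokenLefschetzFibration

end Literature.Topology.FourManifolds

end
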